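import Summits.BirchSwinnertonDyer.Rank1Residual.Additive.TwistedOrdinaryLineOfTwist
import HarnessLib

/-!
# Small (irreducible, non-surjective) mod-`p` image ⟹ `E[p]|_I` is SEMISIMPLE at every
# line-stabilising subgroup `I`: every `I`-stable line has an `I`-stable complement — part 3 of the
# O8-TAME kernel theorems, the form valid at ALL odd `p` (cell `b2b-bsdres`, lane CLASS-CLOSURE,
# seat cc-typer-1 = typer of record N11 / O8; `class-closure/O8/STATEMENT.md` §§12–14; joint
# small-image axis O8 / N2 = X10b@3 / N3 = X9@{5,7})

HONEST FRAMING (cell `b2b-bsdres`, run/shared/lean/b2b/bsd-rank1-residual/, verbatim in every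
file): the goal of the cell is to DELETE the COMBINATION-SHAPED residual classes of the
Birch–Swinnerton-Dyer formula for ALL analytic-rank `≤ 1` elliptic curves over `ℚ` — "full BSD
formula for every rank `≤ 1` curve in class `C`" assembled STRICTLY from published theorems — so
that the rank-`≤ 1` remainder becomes exactly the CONSTRUCTION-SHAPED classes, which are TYPED
(missing-input `Prop`s), NOT attempted. This is not "finishing BSD". Lane CLASS-CLOSURE: research
routes, no claim beyond the stated classes; census output = EVIDENCE, never a Literature fact;
NOTHING is booked here. This file contains THEOREMS ONLY (finite group theory of the image of
`ρ̄_{E,p}` and linear algebra on the `𝔽_p`-plane `E[p]`, over tree predicates); no definition, no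
named fact, no conjecture, no `sorry`.

## What is proved

Parts 1–2 (`GaloisImage/SmallImageAbelianInertia.lean`, `…/SmallImageTameInertia.lean`, same seat):
under `Irr W p ∧ ¬ Surj W p` there is NO unipotent Galois element on `E[p]` (Serre Prop. 15), the
image of a line-stabilising `I ≤ Γ_ℚ` is ABELIAN, and when one diagonal character of `E[p]|_I` is
TRIVIAL (every ordinary-type row at `p = 3`; N2; N3) `E[p]|_I ≅ χ ⊕ 1` (`InertiaSplitAt`).
At an additive pot. multiplicative / `(G-ord, e = 2)` prime `p ≥ 5` NEITHER character is trivial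
(`E = E♭ ⊗ χ_{p*}`: `ω^{(p+1)/2}, ω^{(p−1)/2}`), so the right key there is SEMISIMPLICITY:

* §5 `exists_stable_complement_of_stableLine_of_irr_of_not_surj` — under `Irr W p ∧ ¬ Surj W p`,
  EVERY line `L ≤ E[p]` stable under a subgroup `I ≤ Γ_ℚ` has an `I`-STABLE COMPLEMENT
  (`E[p]|_I = L ⊕ Y`). Proof: `I` acts on `L` and `E[p]/L` by scalars `c(σ), a(σ)`; if some
  `σ₀ ∈ I` has `a(σ₀) ≢ c(σ₀)`, `Y` is its `a(σ₀)`-eigenline (stable by commutativity, part 1);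
  otherwise `σ^{p−1} = 1 + (p−1)c^{p−2}N_σ` (`N_σ = σ − c(σ)`, `N_σ² = 0`, Fermat) is unipotent,
  hence trivial (part 1), so `N_σ = 0`: `I` acts by scalars and any complement serves.
* §6 twist models: an `I`-stable line of `V[p]` transports to one of `W[p]` for `W = C • V^{(d)}`
  along the sign-equivariant `W[p] ≃ V[p]` (`exists_signEquiv_of_twist`, Silverman X.5.4); hence,
  with NO per-pair binder and at EVERY odd `p`: `exists_stablePair_of_classX4Gord_of_not_surj`
  (O8 ∩ X4♯(G-ord), `e = 2`: UNCONDITIONAL — x1a's Serre line of the good ordinary twist model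
  `ClassX4Gord.exists_goodOrd_pStar_twist_model`) and `exists_stablePair_of_classX4M_of_not_surj`
  (O8 ∩ X4(M): X2's Tate line of `ClassX4M.exists_mult_pStar_twist_model`, A40/A41 as hypotheses).

READING (class-closure, `O8/STATEMENT.md` §14, `N11/SUBPARTITION-typed.md` row TAME): on EVERY
twist-ordinary O8 row — (M) and (G-ord, `e = 2`), at `p = 3` (244 rows) AND at `p ∈ {5, 7}` (81 rows,
§10) — `ρ̄_{E,p}|_{I_𝔓}` is a DIRECT SUM OF TWO CHARACTERS with abelian image of order prime to `p`
(Edixhoven 1997 §4.2), as a THEOREM (G-ord: unconditional; (M): modulo A40/A41); at `p = 3` part 2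
sharpens this to `χ ⊕ 1`. NOT covered: potentially supersingular rows, `(G-ord, e ∈ {3,4,6})` rows
(no twist model in the tree), and anything about BSD_p — O8 / N2 / N3 stay OPEN; nothing is booked.

References: J.-P. Serre, Invent. Math. 15 (1972) §1.11, §2.4 Prop. 15 [Serre1972]; B. Edixhoven (1997)
§4.2 [Edixhoven1997Serre]; J. H. Silverman, *AEC* X.5 Cor. 5.4 [SilvermanAEC2009]; O8/STATEMENT §12–14.
-/

set_option autoImplicit false

noncomputable section

open scoped Classical

open WeierstrassCurve Literature.NumberTheory.EllipticCurves Literature.NumberTheory.GaloisRepresentations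
  Field IsDedekindDomain NumberField
  Literature.NumberTheory.EllipticCurves.Rank1Residual
  Summit.BirchSwinnertonDyer.Rank1Residual.Additive.MixedCongruence

namespace Summit.BirchSwinnertonDyer.Rank1Residual.GaloisImage

variable {W : WeierstrassCurve ℚ} [W.IsElliptic] {p : ℕ} [Fact p.Prime]

/-! ## §5. Every stable line has a stable complement in a small image -/

omit [W.IsElliptic] in
/-- An integer `≡ 1 (mod p)` acts as the identity on `E[p]`. [folklore] -/
theorem zsmul_eq_self_of_intCast_eq_one {c : ℤ} (hc : (c : ZMod p) = 1)
    (P : geomTorsion W (p : ℤ)) : c • P = P := by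
  have h1 : ((c - 1 : ℤ) : ZMod p) = 0 := by rw [Int.cast_sub, hc, Int.cast_one, sub_self]
  obtain ⟨m, hm⟩ := (ZMod.intCast_zmod_eq_zero_iff_dvd _ p).mp h1
  have h : c • P = m • ((p : ℤ) • P) + P := by
    rw [smul_smul, show m * (p : ℤ) = c - 1 by linarith, sub_smul, one_smul, sub_add_cancel]
  rw [h, natCast_zsmul_eq_zero, smul_zero, zero_add]

omit [W.IsElliptic] in
/-- A line `L ≤ E[p]` contains a non-zero point. [folklore] -/
theorem exists_mem_ne_zero_of_natCard_eq {L : AddSubgroup (geomTorsion W (p : ℤ))}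
    (hL : Nat.card L = p) : ∃ x ∈ L, x ≠ 0 := by
  have hp : p.Prime := Fact.out
  by_contra h
  push Not at h
  have hbot : L = ⊥ := by
    rw [eq_bot_iff]
    intro x hx
    rw [AddSubgroup.mem_bot]
    exact h x hx
  rw [hbot, AddSubgroup.card_bot] at hL
  exact hp.one_lt.ne hL

omit [W.IsElliptic] in
/-- The scalar by which a Galois element acts on a line it stabilises is invertible mod `p`.
[folklore] -/
theorem intCast_ne_zero_of_forall_mem_smul_eq_zsmul {L : AddSubgroup (geomTorsion W (p : ℤ))}
    (hL : Nat.card L = p) {σ : absoluteGaloisGroup ℚ} {c : ℤ} (hc : ∀ P ∈ L, σ • P = c • P) :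
    (c : ZMod p) ≠ 0 := by
  intro h0
  obtain ⟨x, hx, hx0⟩ := exists_mem_ne_zero_of_natCard_eq hL
  obtain ⟨m, hm⟩ := (ZMod.intCast_zmod_eq_zero_iff_dvd _ p).mp h0
  apply hx0
  have h1 : σ • x = 0 := by
    rw [hc x hx, show c = m * (p : ℤ) by linarith, ← smul_smul, natCast_zsmul_eq_zero, smul_zero]
  rw [← inv_smul_smul σ x, h1, smul_zero]

omit [W.IsElliptic] [Fact p.Prime] in
/-- Iterating `σ = c + N` where `N = σ − c` takes values in a line on which `σ = c`:
`σ^{k+1} P = c^{k+1} P + (k+1) c^k N(P)`. [folklore] -/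
theorem pow_succ_smul_eq_of_forall_mem {L : AddSubgroup (geomTorsion W (p : ℤ))}
    {σ : absoluteGaloisGroup ℚ} {c : ℤ} (hc : ∀ P ∈ L, σ • P = c • P)
    (hN : ∀ P, σ • P - c • P ∈ L) (k : ℕ) (P : geomTorsion W (p : ℤ)) :
    σ ^ (k + 1) • P = c ^ (k + 1) • P + (((k : ℤ) + 1) * c ^ k) • (σ • P - c • P) := by
  induction k with
  | zero =>
    simp only [zero_add, pow_one, pow_zero, Nat.cast_zero, mul_one, one_smul]
    abel
  | succ k ih =>
    rw [pow_succ', mul_smul, ih, smul_add, smul_comm σ (c ^ (k + 1)) P,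
      smul_comm σ (((k : ℤ) + 1) * c ^ k) (σ • P - c • P), hc _ (hN P)]
    push_cast
    generalize σ • P = s
    module

variable (W p) in
/-- **Every stable line has a stable complement (small image ⟹ `E[p]|_I` semisimple).** Under
`Irr W p ∧ ¬ Surj W p`, let `I ≤ Γ_ℚ` stabilise a line `L ≤ E[p]`. Then `L` has an `I`-stable
complement `Y`: `E[p]|_I = L ⊕ Y` is a direct sum of two characters. If some `σ₀ ∈ I` has distinct
scalars on `L` and `E[p]/L`, `Y` is the corresponding eigenline of `σ₀` (stable by commutativity,
`smul_comm_of_stableLine_of_irr_of_not_surj`); otherwise every `σ ∈ I` is a scalar times a unipotent,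
its `(p−1)`-st power is unipotent hence trivial (`smul_eq_self_of_fix_line_of_irr_of_not_surj`), so
`I` acts by scalars and any complement serves. [cite: Serre1972, §2.4 Prop. 15]
[cite: Edixhoven1997Serre, §4.2 (PDF p. 297; ρ|_{I_p} a direct sum of two characters when p ∤ #ρ(I_p))] -/
theorem exists_stable_complement_of_stableLine_of_irr_of_not_surj (hirr : Irr W p) (hns : ¬ Surj W p)
    {I : Subgroup (absoluteGaloisGroup ℚ)} {L : AddSubgroup (geomTorsion W (p : ℤ))}
    (hL : Nat.card L = p) (hst : ∀ σ ∈ I, ∀ P ∈ L, σ • P ∈ L) :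
    ∃ Y : AddSubgroup (geomTorsion W (p : ℤ)), Nat.card Y = p ∧ L ⊓ Y = ⊥ ∧ L ⊔ Y = ⊤ ∧
      ∀ σ ∈ I, ∀ P ∈ Y, σ • P ∈ Y := by
  have hp : p.Prime := Fact.out
  by_cases hsplit : ∃ σ₀ ∈ I, ∃ a c : ℤ, (∀ P ∈ L, σ₀ • P = c • P) ∧ (∀ P, σ₀ • P - a • P ∈ L) ∧
      ((a - c : ℤ) : ZMod p) ≠ 0
  · -- an element with two distinct eigenvalues: its second eigenline is the complement
    obtain ⟨σ₀, hσ₀, a, c, hc, ha, hac⟩ := hsplit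
    obtain ⟨Y, hY⟩ := exists_eigenAddSubgroup (W := W) (p := p) σ₀ a
    obtain ⟨Q₀, hQ₀⟩ := exists_not_mem_of_natCard_eq hL
    obtain ⟨y₀, hy₀⟩ : ∃ y₀, y₀ = σ₀ • Q₀ - a • Q₀ := ⟨_, rfl⟩
    have hy₀L : y₀ ∈ L := hy₀ ▸ ha Q₀
    have hσQ₀ : σ₀ • Q₀ = y₀ + a • Q₀ := by rw [hy₀, sub_add_cancel]
    obtain ⟨P₁, hP₁⟩ : ∃ P₁, P₁ = (a - c) • Q₀ + y₀ := ⟨_, rfl⟩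
    have hP₁Y : P₁ ∈ Y := by
      rw [hY, hP₁, smul_add, hc y₀ hy₀L, smul_comm σ₀ (a - c) Q₀, hσQ₀]
      module
    have hP₁L : P₁ ∉ L := by
      intro h
      apply hQ₀
      have h2 : (a - c) • Q₀ ∈ L := by
        have h3 := L.sub_mem h hy₀L
        rwa [hP₁, add_sub_cancel_right] at h3
      exact mem_of_zsmul_mem hac h2
    have hYbot : Y ≠ ⊥ := by
      intro h
      apply hP₁L
      have h0 : P₁ = 0 := by rw [← AddSubgroup.mem_bot, ← h]; exact hP₁Y
      rw [h0]
      exact L.zero_mem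
    have hYL : Y ⊓ L = ⊥ := by
      rw [eq_bot_iff]
      intro P hP
      rw [AddSubgroup.mem_inf] at hP
      rw [AddSubgroup.mem_bot]
      apply eq_zero_of_zsmul_eq_zero hac
      rw [sub_smul, ← (hY P).mp hP.1, hc P hP.2, sub_self]
    have hYcard : Nat.card Y = p := natCard_eq_of_ne_bot_of_inf_eq_bot hYbot hL hYL
    have hne : L ≠ Y := by
      intro h
      rw [h, inf_idem] at hYL
      have h1 : Nat.card Y = 1 := by rw [hYL]; exact AddSubgroup.card_bot
      exact hp.one_lt.ne' (hYcard.symm.trans h1)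
    refine ⟨Y, hYcard, by rwa [inf_comm] at hYL,
      sup_eq_top_of_ne (Literature.NumberTheory.EllipticCurves.natCard_geomTorsion W p) hL hYcard hne,
      ?_⟩
    intro τ hτ P hP
    rw [hY] at hP ⊢
    rw [smul_comm_of_stableLine_of_irr_of_not_surj W p hirr hns hL hst hσ₀ hτ P, hP, smul_comm τ a P]
  · -- every element of `I` acts on `E[p]` by a scalar
    push Not at hsplit
    have hscalar : ∀ σ ∈ I, ∃ c : ℤ, ∀ P : geomTorsion W (p : ℤ), σ • P = c • P := by
      intro σ hσ
      obtain ⟨c, hc⟩ := exists_int_forall_mem_smul_eq_zsmul hL (hst σ hσ)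
      obtain ⟨a, ha⟩ := exists_int_forall_smul_sub_zsmul_mem hL (hst σ hσ)
      have hac : ((a - c : ℤ) : ZMod p) = 0 := hsplit σ hσ a c hc ha
      -- `N = σ − c` maps `E[p]` into `L` (and kills `L`)
      have hN : ∀ P, σ • P - c • P ∈ L := by
        intro P
        obtain ⟨m, hm⟩ := (ZMod.intCast_zmod_eq_zero_iff_dvd _ p).mp hac
        have h : σ • P - c • P = (σ • P - a • P) + m • ((p : ℤ) • P) := by
          rw [smul_smul, show m * (p : ℤ) = a - c by linarith]
          generalize σ • P = s
          module
        rw [h, natCast_zsmul_eq_zero, smul_zero, add_zero]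
        exact ha P
      have hc0 : (c : ZMod p) ≠ 0 := intCast_ne_zero_of_forall_mem_smul_eq_zsmul hL hc
      have hcp : ((c ^ (p - 1) : ℤ) : ZMod p) = 1 := by
        rw [Int.cast_pow]
        exact ZMod.pow_card_sub_one_eq_one hc0
      -- `τ = σ^{p-1} = 1 + (p-1) c^{p-2} N` is unipotent, hence trivial
      have hiter := pow_succ_smul_eq_of_forall_mem hc hN (p - 2)
      have hp2 : p - 2 + 1 = p - 1 := by have := hp.two_le; omega
      rw [hp2] at hiter
      have hfix : ∀ x ∈ L, σ ^ (p - 1) • x = x := by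
        intro x hx
        rw [hiter, hc x hx, sub_self, smul_zero, add_zero, zsmul_eq_self_of_intCast_eq_one hcp]
      have hquot : ∀ P, σ ^ (p - 1) • P - P ∈ L := by
        intro P
        rw [hiter, zsmul_eq_self_of_intCast_eq_one hcp, add_sub_cancel_left]
        exact L.zsmul_mem (hN P) _
      have htriv := smul_eq_self_of_fix_line_of_irr_of_not_surj W p hirr hns hfix hquot
      have hcoef : (((((p - 2 : ℕ) : ℤ) + 1) * c ^ (p - 2) : ℤ) : ZMod p) ≠ 0 := by
        have e1 : (((p - 2 : ℕ) : ℤ) + 1 : ℤ) = ((p - 1 : ℕ) : ℤ) := by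
          have := hp.two_le
          push_cast [Nat.cast_sub this, Nat.cast_sub hp.one_lt.le]
          ring
        rw [e1, Int.cast_mul, Int.cast_pow, Int.cast_natCast, Nat.cast_sub hp.one_lt.le,
          Nat.cast_one, ZMod.natCast_self, zero_sub, neg_one_mul, neg_ne_zero]
        exact pow_ne_zero _ hc0
      refine ⟨c, fun P ↦ ?_⟩
      have h := htriv P
      rw [hiter, zsmul_eq_self_of_intCast_eq_one hcp, add_eq_left] at h
      rw [← sub_eq_zero]
      exact eq_zero_of_zsmul_eq_zero hcoef h
    -- any complement of `L` is `I`-stable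
    obtain ⟨Q₀, hQ₀⟩ := exists_not_mem_of_natCard_eq hL
    have hQ₀0 : Q₀ ≠ 0 := fun h ↦ hQ₀ (h ▸ L.zero_mem)
    have hord : addOrderOf Q₀ = p :=
      addOrderOf_eq_prime (by rw [← natCast_zsmul]; exact natCast_zsmul_eq_zero Q₀) hQ₀0
    have hY : Nat.card (AddSubgroup.zmultiples Q₀) = p := by rw [Nat.card_zmultiples, hord]
    have hne : L ≠ AddSubgroup.zmultiples Q₀ := fun h ↦ hQ₀ (h ▸ AddSubgroup.mem_zmultiples Q₀)
    refine ⟨AddSubgroup.zmultiples Q₀, hY, (line_eq_or_inf_eq_bot hL hY).resolve_left hne,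
      sup_eq_top_of_ne (Literature.NumberTheory.EllipticCurves.natCard_geomTorsion W p) hL hY hne,
      fun σ hσ P hP ↦ ?_⟩
    obtain ⟨c, hc⟩ := hscalar σ hσ
    rw [hc P]
    exact AddSubgroup.zsmul_mem _ hP c

variable (W p) in
/-- **Small image ⟹ `E[p]|_I` semisimple, packaged:** under `Irr W p ∧ ¬ Surj W p`, if `I ≤ Γ_ℚ`
stabilises SOME line of `E[p]` then `E[p] = X ⊕ Y` with BOTH lines `I`-stable (the shape
`InertiaSplitAt W p I` without its pointwise-fixed clause). [cite: Serre1972, §2.4 Prop. 15]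
[cite: Edixhoven1997Serre, §4.2 (PDF p. 297)] -/
theorem exists_stablePair_of_stableLine_of_irr_of_not_surj (hirr : Irr W p) (hns : ¬ Surj W p)
    {I : Subgroup (absoluteGaloisGroup ℚ)}
    (hL : ∃ L : AddSubgroup (geomTorsion W (p : ℤ)), Nat.card L = p ∧ ∀ σ ∈ I, ∀ P ∈ L, σ • P ∈ L) :
    ∃ X Y : AddSubgroup (geomTorsion W (p : ℤ)), Nat.card X = p ∧ Nat.card Y = p ∧
      X ⊓ Y = ⊥ ∧ X ⊔ Y = ⊤ ∧
      (∀ σ ∈ I, ∀ P ∈ X, σ • P ∈ X) ∧ (∀ σ ∈ I, ∀ P ∈ Y, σ • P ∈ Y) := by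
  obtain ⟨L, hL, hst⟩ := hL
  obtain ⟨Y, hY, hinf, hsup, hYst⟩ :=
    exists_stable_complement_of_stableLine_of_irr_of_not_surj W p hirr hns hL hst
  exact ⟨L, Y, hL, hY, hinf, hsup, hst, hYst⟩

omit [W.IsElliptic] in
/-- An inertia-split `E[p]` is in particular a stable pair (the `p = 3` key implies the all-`p`
key). [folklore] -/
theorem exists_stablePair_of_inertiaSplitAt {I : Subgroup (absoluteGaloisGroup ℚ)}
    (h : InertiaSplitAt W p I) :
    ∃ X Y : AddSubgroup (geomTorsion W (p : ℤ)), Nat.card X = p ∧ Nat.card Y = p ∧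
      X ⊓ Y = ⊥ ∧ X ⊔ Y = ⊤ ∧
      (∀ σ ∈ I, ∀ P ∈ X, σ • P ∈ X) ∧ (∀ σ ∈ I, ∀ P ∈ Y, σ • P ∈ Y) := by
  obtain ⟨X, Y, hX, hY, hinf, hsup, hXst, hYfix⟩ := h
  exact ⟨X, Y, hX, hY, hinf, hsup, hXst, fun σ hσ P hP ↦ by rw [hYfix σ hσ P hP]; exact hP⟩

/-! ## §6. Twist models: stable lines transport along `W = C • V^{(d)}`; O8 class forms at every odd `p` -/

omit [W.IsElliptic] [Fact p.Prime] in
/-- **Transport of a stable line through a quadratic twist.** For `W = C • V^{(d)}` and the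
sign-equivariant `e : W[p] ≃ V[p]` (`e(σT) = χ_d(σ) σ e(T)`, Silverman X.5.4), the preimage of an
`I`-stable line of `V[p]` is an `I`-stable line of `W[p]` (a sign preserves membership).
[cite: SilvermanAEC2009, X.5 Cor. 5.4] -/
theorem exists_stableLine_of_twist_model {V : WeierstrassCurve ℚ} [V.IsElliptic] {d : ℚ}
    (hd0 : d ≠ 0) (C : VariableChange ℚ) (hC : C • V.quadraticTwist d = W)
    {I : Subgroup (absoluteGaloisGroup ℚ)} {X : AddSubgroup (geomTorsion V (p : ℤ))}
    (hX : Nat.card X = p) (hXst : ∀ σ ∈ I, ∀ P ∈ X, σ • P ∈ X) :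
    ∃ L : AddSubgroup (geomTorsion W (p : ℤ)), Nat.card L = p ∧ ∀ σ ∈ I, ∀ P ∈ L, σ • P ∈ L := by
  have hC' : C⁻¹ • W = V.quadraticTwist d := by rw [← hC, inv_smul_smul]
  obtain ⟨e, hpos, hneg⟩ := exists_signEquiv_of_twist (W := V) (Wd := W) (p := p) hd0 C⁻¹ hC'
  refine ⟨X.map e.symm.toAddMonoidHom,
    (Nat.card_congr (X.equivMapOfInjective e.symm.toAddMonoidHom e.symm.injective).toEquiv).symm.trans
      hX, ?_⟩
  intro σ hσ P hP
  rw [AddSubgroup.mem_map_equiv, AddEquiv.symm_symm] at hP ⊢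
  by_cases hs : σ • geomSqrt d = geomSqrt d
  · rw [hpos σ hs]
    exact hXst σ hσ _ hP
  · rw [hneg σ hs]
    exact X.neg_mem (hXst σ hσ _ hP)

omit [W.IsElliptic] in
/-- An unramified-quotient line of `V[p]` at `I` gives an `I`-stable line of `W[p]` for every twist
model `W = C • V^{(d)}`. [cite: SilvermanAEC2009, X.5 Cor. 5.4] -/
theorem exists_stableLine_of_unramifiedQuotientLineAt_twist_model {V : WeierstrassCurve ℚ}
    [V.IsElliptic] {d : ℚ} (hd0 : d ≠ 0) (C : VariableChange ℚ) (hC : C • V.quadraticTwist d = W)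
    {I : Subgroup (absoluteGaloisGroup ℚ)} (hA : UnramifiedQuotientLineAt V p I) :
    ∃ L : AddSubgroup (geomTorsion W (p : ℤ)), Nat.card L = p ∧ ∀ σ ∈ I, ∀ P ∈ L, σ • P ∈ L := by
  obtain ⟨X, hX, hXsub⟩ := hA
  refine exists_stableLine_of_twist_model hd0 C hC hX fun σ hσ P hP ↦ ?_
  have h : σ • P = (σ • P - P) + P := by abel
  rw [h]
  exact X.add_mem (hXsub σ hσ P) hP

end Summit.BirchSwinnertonDyer.Rank1Residual.GaloisImage

namespace Summit.BirchSwinnertonDyer.Rank1Residual.Additive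

open Summit.BirchSwinnertonDyer.Rank1Residual.GaloisImage

variable (W : WeierstrassCurve ℚ) [W.IsElliptic] (p : ℕ) [Fact p.Prime]

/-- **O8 rows with a GOOD ORDINARY twist model `W = C • V^{(p*)}`, every odd `p`: `E[p]|_{I_𝔓}` is
a direct sum of two `I_𝔓`-stable lines** at every inertia group above `p` (x1a's Serre §1.11 line of
`V` transported, plus §5). No per-pair binder.
[cite: Serre1972, §1.11 Prop. 11 and §2.4 Prop. 15] [cite: SilvermanAEC2009, X.5 Cor. 5.4] -/
theorem O8.exists_stablePair_of_goodOrd_twist_model (hX : ClassX4 W p) (hns : ¬ Surj W p)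
    {V : WeierstrassCurve ℚ} [V.IsElliptic] [V.IsGloballyMinimal]
    (hgood : V.HasGoodReductionAtPrime p) (hord : ¬ (p : ℤ) ∣ V.frobeniusTrace p)
    (C : VariableChange ℚ) (hC : C • V.quadraticTwist ((-1 : ℚ) ^ (p / 2) * p) = W)
    {v : HeightOneSpectrum (𝓞 ℚ)} (hv : (p : 𝓞 ℚ) ∈ v.asIdeal)
    {𝔓 : Ideal (absIntegers (𝓞 ℚ) ℚ)} (h𝔓 : 𝔓 ∈ v.primesAbove) :
    ∃ X Y : AddSubgroup (geomTorsion W (p : ℤ)), Nat.card X = p ∧ Nat.card Y = p ∧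
      X ⊓ Y = ⊥ ∧ X ⊔ Y = ⊤ ∧
      (∀ σ ∈ 𝔓.inertia (absoluteGaloisGroup ℚ), ∀ P ∈ X, σ • P ∈ X) ∧
      (∀ σ ∈ 𝔓.inertia (absoluteGaloisGroup ℚ), ∀ P ∈ Y, σ • P ∈ Y) := by
  have hp : p.Prime := Fact.out
  have hd0 : ((-1 : ℚ) ^ (p / 2) * p) ≠ 0 :=
    mul_ne_zero (pow_ne_zero _ (by norm_num)) (Nat.cast_ne_zero.mpr hp.ne_zero)
  exact exists_stablePair_of_stableLine_of_irr_of_not_surj W p hX.2.2 hns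
    (exists_stableLine_of_unramifiedQuotientLineAt_twist_model hd0 C hC
      (unramifiedQuotientLineAt_of_goodOrdinary hX.1 hgood hord hv h𝔓))

/-- **O8 ∩ X4♯(G-ord), `e = 2`, every odd `p` — UNCONDITIONAL:** for a globally minimal O8 pair of
type (G)-ordinary with `semistabilityIndex W p = 2`, `E[p]|_{I_𝔓}` is a direct sum of two
`I_𝔓`-stable lines at every `𝔓 ∣ p` (at `p = 3`, `inertiaSplitAt_three_of_classX4Gord_of_not_surj`
is sharper: `χ ⊕ 1`). [cite: Serre1972, §1.11 Prop. 11 and §2.4 Prop. 15]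
[cite: Edixhoven1997Serre, §4.2 (PDF p. 297)] -/
theorem exists_stablePair_of_classX4Gord_of_not_surj [W.IsGloballyMinimal] (hX : ClassX4Gord W p)
    (he : semistabilityIndex W p = 2) (hns : ¬ Surj W p)
    {v : HeightOneSpectrum (𝓞 ℚ)} (hv : (p : 𝓞 ℚ) ∈ v.asIdeal)
    {𝔓 : Ideal (absIntegers (𝓞 ℚ) ℚ)} (h𝔓 : 𝔓 ∈ v.primesAbove) :
    ∃ X Y : AddSubgroup (geomTorsion W (p : ℤ)), Nat.card X = p ∧ Nat.card Y = p ∧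
      X ⊓ Y = ⊥ ∧ X ⊔ Y = ⊤ ∧
      (∀ σ ∈ 𝔓.inertia (absoluteGaloisGroup ℚ), ∀ P ∈ X, σ • P ∈ X) ∧
      (∀ σ ∈ 𝔓.inertia (absoluteGaloisGroup ℚ), ∀ P ∈ Y, σ • P ∈ Y) := by
  obtain ⟨V, iV, iVm, C, hgo, hC⟩ := ClassX4Gord.exists_goodOrd_pStar_twist_model W p hX he
  exact O8.exists_stablePair_of_goodOrd_twist_model W p hX.classX4 hns hgo.1 hgo.2 C hC hv h𝔓

/-- **O8, (M) rows, every odd `p` (A40/A41 granted):** `W = C • V^{(p*)}`, `V` globally minimal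
and MULTIPLICATIVE at `p`: at the inertia group of the tree's chosen prime above `p`, `E[p]|_{I_𝔓}`
is a direct sum of two `I_𝔓`-stable lines (X2's Tate line of `V` transported, plus §5).
[cite: SilvermanATAEC1994, V.5.3 and V.5.4 (Tate uniformisation)] [cite: Serre1972, §2.4 Prop. 15] -/
theorem O8.exists_stablePair_of_mult_twist_model (hX : ClassX4 W p) (hns : ¬ Surj W p)
    {V : WeierstrassCurve ℚ} [V.IsElliptic] [V.IsGloballyMinimal]
    (hT : Silverman1994_thmV53_tateUniformisation.{0})
    (hT' : Silverman1994_thmV53_corV54_tateUniformisation.{0})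
    (hmult : V.HasMultiplicativeReductionAtPrime p)
    (C : VariableChange ℚ) (hC : C • V.quadraticTwist ((-1 : ℚ) ^ (p / 2) * p) = W) :
    ∃ (v : HeightOneSpectrum (𝓞 ℚ)), (p : 𝓞 ℚ) ∈ v.asIdeal ∧ ∃ 𝔓 ∈ v.primesAbove,
      ∃ X Y : AddSubgroup (geomTorsion W (p : ℤ)), Nat.card X = p ∧ Nat.card Y = p ∧
        X ⊓ Y = ⊥ ∧ X ⊔ Y = ⊤ ∧
        (∀ σ ∈ 𝔓.inertia (absoluteGaloisGroup ℚ), ∀ P ∈ X, σ • P ∈ X) ∧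
        (∀ σ ∈ 𝔓.inertia (absoluteGaloisGroup ℚ), ∀ P ∈ Y, σ • P ∈ Y) := by
  have hp : p.Prime := Fact.out
  have hd0 : ((-1 : ℚ) ^ (p / 2) * p) ≠ 0 :=
    mul_ne_zero (pow_ne_zero _ (by norm_num)) (Nat.cast_ne_zero.mpr hp.ne_zero)
  obtain ⟨v, hv, 𝔓, h𝔓, hA⟩ := exists_unramifiedQuotientLineAt_of_multiplicative hT hT' hX.1 hmult
  exact ⟨v, hv, 𝔓, h𝔓, exists_stablePair_of_stableLine_of_irr_of_not_surj W p hX.2.2 hns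
    (exists_stableLine_of_unramifiedQuotientLineAt_twist_model hd0 C hC hA)⟩

/-- **O8 ∩ X4(M), every odd `p` (A40/A41 granted):** `E[p]|_{I_𝔓}` is a direct sum of two
`I_𝔓`-stable lines at the inertia group of the tree's chosen prime above `p` (twist model:
`ClassX4M.exists_mult_pStar_twist_model`). [cite: SilvermanATAEC1994, V.5.3 and V.5.4 (Tate uniformisation)]
[cite: Serre1972, §2.4 Prop. 15] -/
theorem exists_stablePair_of_classX4M_of_not_surj
    (hX : Summit.BirchSwinnertonDyer.Rank1Residual.AdditivePotMult.ClassX4M W p) (hns : ¬ Surj W p)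
    (hT : Silverman1994_thmV53_tateUniformisation.{0})
    (hT' : Silverman1994_thmV53_corV54_tateUniformisation.{0}) :
    ∃ (v : HeightOneSpectrum (𝓞 ℚ)), (p : 𝓞 ℚ) ∈ v.asIdeal ∧ ∃ 𝔓 ∈ v.primesAbove,
      ∃ X Y : AddSubgroup (geomTorsion W (p : ℤ)), Nat.card X = p ∧ Nat.card Y = p ∧
        X ⊓ Y = ⊥ ∧ X ⊔ Y = ⊤ ∧
        (∀ σ ∈ 𝔓.inertia (absoluteGaloisGroup ℚ), ∀ P ∈ X, σ • P ∈ X) ∧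
        (∀ σ ∈ 𝔓.inertia (absoluteGaloisGroup ℚ), ∀ P ∈ Y, σ • P ∈ Y) := by
  obtain ⟨V, iV, iVm, C, hmV, hC⟩ := hX.exists_mult_pStar_twist_model
  exact O8.exists_stablePair_of_mult_twist_model W p hX.classX4 hns hT hT' hmV C hC

end Summit.BirchSwinnertonDyer.Rank1Residual.Additive

end
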